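import Literature.AnabelianGeometry.SemiGraphs.ProSigmaFreeFactorCompletion
import Literature.AnabelianGeometry.SemiGraphs.ProSigmaCuspInertiaMalnormalHolds
import Literature.AnabelianGeometry.SemiGraphs.SurfaceTypeCoveringsToolkit
import Literature.AnabelianGeometry.SemiGraphs.ProSigmaCompletionRestrict
import Literature.GroupTheory.CombinatorialGroupTheory.PuncturedSurfaceGroupUnrQuotientCoprod
import HarnessLib

/-!
# The closed node group of an UNMARKED component is malnormal: `cl ι⟨∏_{i≥g₀}[a_i,b_i]⟩` as a boundary cusp

Mochizuki, *Semi-graphs of anabelioids* [SemiAnbd] Example 2.10 p. 31 / *The absolute anabelian geometry of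
hyperbolic curves* [AbsAnab] Lemma 1.3.7: the closed cusp inertia groups of the pro-`Σ` completion of a
hyperbolic punctured surface group are infinite and malnormal — in the tree, abc-iut-L3-t11's named fact
`ProSigmaCuspInertiaMalnormal`, PROVED (`proSigmaCuspInertiaMalnormal_holds`, boundary case `r = 1`
included) [cite: MochizukiSemiAnbd2006, Ex. 2.10 p.31].  Used here for [CombGC] Prop. 1.2 (ii)
[cite: MochizukiCombGC2007, Prop 1.2(ii) p.8] at the two-component data with an UNMARKED component
(abc-iut-f-164 gen 2, `PSCTwoComponentUnmarkedOrigin.lean`), whose node group is `Π_ν = cl ι⟨ε⟩` with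
`ε = w⁻¹`, `w = ∏_{i ≥ g₀}[a_i, b_i]` a product of commutators — a member of NO free basis of `Γ_{g,r}`, so
that the rank-one free-factor engine of the pointed / affine shapes does not apply.

PROOF-ONLY file (abc-iut-f-166 gen 5), theorems only:

* `PuncturedSurfaceGroup.nodeLoop_eq_inv_of_unmarked` — `ε = w⁻¹` (the surface relation, `s = 0`);
* `PuncturedSurfaceGroup.exists_mulEquiv_secondHandles` — the second subsurface group
  `F₁ = ⟨a_i, b_i : i ≥ g₀⟩ ≤ Γ_{g₀+g₁, r'+1}` is a copy of `Γ_{g₁,1}` with `c_0 ↦ w⁻¹` (Tietze map through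
  `PresentedGroup.toGroup`; injective by the retraction onto the second block of handles);
* `secondHandleProd_closure_infinite_and_inf_conj_eq_bot` — for a profinite pro-`Σ` completion
  `ι : Γ_{g₀+g₁,r'+1} → Π`, `g₁ ≥ 1`: `I = cl ι⟨w⟩` is INFINITE and MALNORMAL, `I ∩ xIx⁻¹ = 1` for all `x ∉ I`.
  Route: `F₁` is a free factor (`r'+1 ≥ 1`), so `cl ι(F₁)` is the pro-`Σ` completion of `Γ_{g₁,1}`
  (abc-iut-L5-t6's `freeFactor_isProSigmaCompletion`) with `I` its closed BOUNDARY cusp inertia — infinite and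
  malnormal inside `cl ι(F₁)` by `proSigmaCuspInertiaMalnormal_holds`; and `cl ι(F₁) ∩ x cl ι(F₁) x⁻¹ = 1`
  for `x ∉ cl ι(F₁)` (`freeFactor_inf_conj_eq_bot`, Ribes–Zalesskii Thm. 9.1.12).

Plain (pro)finite group theory; 0 definitions; nothing here takes a side on [IUTchIII] Cor. 3.12.
-/

noncomputable section

open scoped Pointwise

/-! ### The second subsurface group `⟨a_i, b_i : i ≥ g₀⟩ ≅ Γ_{g₁,1}` with boundary `(∏_{i≥g₀}[a_i,b_i])⁻¹` -/

namespace Literature.GroupTheory.CombinatorialGroupTheory.PuncturedSurfaceGroup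

variable {g r : ℕ}

/-- At two-component data with `C₁` unmarked (`s = 0`) the node loop `ε = (c_0⋯c_{r−1})·∏_{i<g₀}[a_i,b_i]`
is the INVERSE of the handle product `w = ∏_{i≥g₀}[a_i,b_i]` of the second component (the surface relation,
`nodeLoop_rel` with `s = 0`). [cite: MochizukiSemiAnbd2006, Ex. 2.10 p.31] -/
theorem nodeLoop_eq_inv_of_unmarked (g₀ : ℕ) (ε : PuncturedSurfaceGroup g r)
    (hε : ε = ((List.finRange r).map fun j : Fin r => if 0 ≤ (j : ℕ) then c (g := g) j else 1).prod *
      ((List.finRange g).map fun i : Fin g => if (i : ℕ) < g₀ then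
        a (r := r) i * b i * (a i)⁻¹ * (b i)⁻¹ else 1).prod) :
    ε = (((List.finRange g).map fun i : Fin g => if g₀ ≤ (i : ℕ) then
        a (r := r) i * b i * (a i)⁻¹ * (b i)⁻¹ else 1).prod)⁻¹ := by
  have h := nodeLoop_rel (g := g) (r := r) g₀ 0 ε hε
  have h1 : ((List.finRange r).map fun j : Fin r => if (j : ℕ) < 0 then c (g := g) j else 1).prod = 1 :=
    List.prod_eq_one fun y hy => by
      obtain ⟨j, -, rfl⟩ := List.mem_map.mp hy
      rw [if_neg (Nat.not_lt_zero _)]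
  rw [h1, mul_one] at h
  exact (eq_inv_of_mul_eq_one_right h)

/-- The handle product of the second block, re-indexed: `∏_{i ≥ g₀}[a_i,b_i]` over `Fin (g₀+g₁)` equals
`∏_{j<g₁}[a_{g₀+j}, b_{g₀+j}]`. [cite: MochizukiSemiAnbd2006, Ex. 2.10 p.31] -/
theorem secondHandleProd_eq (g₀ g₁ : ℕ) :
    ((List.finRange (g₀ + g₁)).map fun i : Fin (g₀ + g₁) => if g₀ ≤ (i : ℕ) then
        a (r := r) i * b i * (a i)⁻¹ * (b i)⁻¹ else 1).prod =
      ((List.finRange g₁).map fun j : Fin g₁ =>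
        a (r := r) (Fin.natAdd g₀ j) * b (Fin.natAdd g₀ j) * (a (Fin.natAdd g₀ j))⁻¹ *
          (b (Fin.natAdd g₀ j))⁻¹).prod := by
  rw [prod_map_finRange_add]
  have h1 : ((List.finRange g₀).map fun i : Fin g₀ =>
      if g₀ ≤ ((Fin.castAdd g₁ i : Fin (g₀ + g₁)) : ℕ) then
        a (r := r) (Fin.castAdd g₁ i) * b (Fin.castAdd g₁ i) * (a (Fin.castAdd g₁ i))⁻¹ *
          (b (Fin.castAdd g₁ i))⁻¹ else 1).prod = 1 :=
    List.prod_eq_one fun y hy => by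
      obtain ⟨i, -, rfl⟩ := List.mem_map.mp hy
      rw [if_neg (by simp)]
  rw [h1, one_mul]
  refine congrArg List.prod (List.map_congr_left fun j _ => ?_)
  rw [if_pos (by simp)]

/-- **The second subsurface group is a copy of `Γ_{g₁,1}` with boundary cusp `w⁻¹`.**  For a free basis
`b₀` of `Γ_{g₀+g₁, r'+1}` with `b₀(i,·) = a_i, b_i`, the sub-basis closure `F₁ = ⟨b₀(x) : x = (i,·), i ≥ g₀⟩ =
⟨a_i, b_i : i ≥ g₀⟩` receives an isomorphism `e : Γ_{g₁,1} ≃* F₁` with `e(a_j) = a_{g₀+j}`, `e(b_j) = b_{g₀+j}`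
and `e(c_0) = (∏_{i≥g₀}[a_i,b_i])⁻¹` (Tietze: `c_0 = (∏[a_j,b_j])⁻¹` in `Γ_{g₁,1}`; injectivity by the
retraction of `Γ_{g₀+g₁,r'+1}` onto the handles of the second block). [cite: MochizukiSemiAnbd2006, Ex. 2.10 p.31] -/
theorem exists_mulEquiv_secondHandles (g₀ g₁ r' : ℕ)
    (b₀ : FreeGroupBasis ((Fin (g₀ + g₁) × Bool) ⊕ Fin r') (PuncturedSurfaceGroup (g₀ + g₁) (r' + 1)))
    (ha : ∀ i, b₀ (Sum.inl (i, false)) = a i) (hb : ∀ i, b₀ (Sum.inl (i, true)) = b i) :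
    ∃ e : PuncturedSurfaceGroup g₁ 1 ≃*
        Subgroup.closure (b₀ '' {x | Sum.elim (fun p : Fin (g₀ + g₁) × Bool => g₀ ≤ (p.1 : ℕ))
          (fun _ : Fin r' => False) x}),
      (∀ j, (e (a j) : PuncturedSurfaceGroup (g₀ + g₁) (r' + 1)) = a (Fin.natAdd g₀ j)) ∧
      (∀ j, (e (b j) : PuncturedSurfaceGroup (g₀ + g₁) (r' + 1)) = b (Fin.natAdd g₀ j)) ∧
      (e (c 0) : PuncturedSurfaceGroup (g₀ + g₁) (r' + 1)) =
        (((List.finRange (g₀ + g₁)).map fun i : Fin (g₀ + g₁) => if g₀ ≤ (i : ℕ) then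
          a (r := r' + 1) i * b i * (a i)⁻¹ * (b i)⁻¹ else 1).prod)⁻¹ := by
  classical
  set S₁ : Set ((Fin (g₀ + g₁) × Bool) ⊕ Fin r') :=
    {x | Sum.elim (fun p : Fin (g₀ + g₁) × Bool => g₀ ≤ (p.1 : ℕ)) (fun _ : Fin r' => False) x} with hS₁
  set F₁ : Subgroup (PuncturedSurfaceGroup (g₀ + g₁) (r' + 1)) := Subgroup.closure (b₀ '' S₁) with hF₁
  set w : PuncturedSurfaceGroup (g₀ + g₁) (r' + 1) :=
    ((List.finRange (g₀ + g₁)).map fun i : Fin (g₀ + g₁) => if g₀ ≤ (i : ℕ) then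
      a (r := r' + 1) i * b i * (a i)⁻¹ * (b i)⁻¹ else 1).prod with hw
  -- the Tietze map `Γ_{g₁,1} → Γ_{g₀+g₁, r'+1}`
  let f : puncturedSurfaceGen g₁ 1 → PuncturedSurfaceGroup (g₀ + g₁) (r' + 1) :=
    Sum.elim (fun p => if p.2 then b (Fin.natAdd g₀ p.1) else a (Fin.natAdd g₀ p.1)) fun _ => w⁻¹
  have hrel : ∀ v ∈ ({relator g₁ 1} : Set (FreeGroup (puncturedSurfaceGen g₁ 1))),
      FreeGroup.lift f v = 1 := by
    intro v hv
    rw [Set.mem_singleton_iff] at hv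
    subst hv
    simp only [relator, map_mul, map_list_prod, List.map_map, Function.comp_def, map_inv, genA, genB,
      genC, FreeGroup.lift_apply_of]
    have h2 : ((List.finRange 1).map fun _ : Fin 1 => f (Sum.inr 0)).prod = w⁻¹ := by
      simp [f]
    have h2' : ((List.finRange 1).map fun k : Fin 1 => f (Sum.inr k)).prod = w⁻¹ := by
      rw [← h2]
      refine congrArg List.prod (List.map_congr_left fun k _ => ?_)
      rw [Fin.eq_zero k]
    rw [h2', hw, secondHandleProd_eq]
    simp [f]
  let φ : PuncturedSurfaceGroup g₁ 1 →* PuncturedSurfaceGroup (g₀ + g₁) (r' + 1) := PresentedGroup.toGroup hrel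
  have hφa : ∀ j, φ (a j) = a (Fin.natAdd g₀ j) := fun j => by
    change PresentedGroup.toGroup hrel (PresentedGroup.of _) = _
    rw [PresentedGroup.toGroup.of]; simp [f]
  have hφb : ∀ j, φ (b j) = b (Fin.natAdd g₀ j) := fun j => by
    change PresentedGroup.toGroup hrel (PresentedGroup.of _) = _
    rw [PresentedGroup.toGroup.of]; simp [f]
  have hφc : φ (c 0) = w⁻¹ := by
    change PresentedGroup.toGroup hrel (PresentedGroup.of _) = _
    rw [PresentedGroup.toGroup.of]; simp [f]
  -- the range of `φ` is `F₁`
  have hmemF : ∀ (j : Fin g₁) (bit : Bool), b₀ (Sum.inl (Fin.natAdd g₀ j, bit)) ∈ F₁ := fun j bit =>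
    Subgroup.subset_closure ⟨Sum.inl (Fin.natAdd g₀ j, bit), by simp [hS₁], rfl⟩
  have haF : ∀ j : Fin g₁, a (r := r' + 1) (Fin.natAdd g₀ j) ∈ F₁ := fun j => by
    rw [← ha]; exact hmemF j false
  have hbF : ∀ j : Fin g₁, b (r := r' + 1) (Fin.natAdd g₀ j) ∈ F₁ := fun j => by
    rw [← hb]; exact hmemF j true
  have hwF : w ∈ F₁ := by
    rw [hw, secondHandleProd_eq]
    exact Subgroup.list_prod_mem _ fun y hy => by
      obtain ⟨j, -, rfl⟩ := List.mem_map.mp hy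
      exact F₁.mul_mem (F₁.mul_mem (F₁.mul_mem (haF j) (hbF j)) (F₁.inv_mem (haF j)))
        (F₁.inv_mem (hbF j))
  have hrange : φ.range = F₁ := by
    apply le_antisymm
    · rw [MonoidHom.range_eq_map, ← PresentedGroup.closure_range_of, MonoidHom.map_closure,
        Subgroup.closure_le]
      rintro _ ⟨_, ⟨x, rfl⟩, rfl⟩
      rcases x with ⟨j, _ | _⟩ | k
      · change φ (a j) ∈ F₁
        rw [hφa]; exact haF j
      · change φ (b j) ∈ F₁
        rw [hφb]; exact hbF j
      · rw [Fin.eq_zero k]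
        change φ (c 0) ∈ F₁
        rw [hφc]; exact F₁.inv_mem hwF
    · rw [hF₁, Subgroup.closure_le]
      rintro _ ⟨x, hx, rfl⟩
      rcases x with ⟨i, bit⟩ | k
      · have hi : g₀ ≤ (i : ℕ) := hx
        obtain ⟨j, rfl⟩ : ∃ j : Fin g₁, i = Fin.natAdd g₀ j :=
          ⟨⟨i - g₀, by omega⟩, Fin.ext (by simp; omega)⟩
        cases bit
        · exact ⟨a j, by rw [hφa, ha]⟩
        · exact ⟨b j, by rw [hφb, hb]⟩
      · exact absurd hx (by simp [hS₁])
  -- injectivity: a retraction of `Γ_{g₀+g₁,r'+1}` onto `Γ_{g₁,1}` through the free bases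
  obtain ⟨b₁, hb₁a, hb₁b, -⟩ := exists_freeGroupBasis_elim_zero g₁ 0
  let ρ : PuncturedSurfaceGroup (g₀ + g₁) (r' + 1) →* PuncturedSurfaceGroup g₁ 1 :=
    b₀.lift (Sum.elim (fun p => if h : g₀ ≤ (p.1 : ℕ) then
      b₁ (Sum.inl (⟨(p.1 : ℕ) - g₀, by omega⟩, p.2)) else 1) fun _ => 1)
  have hρ : ∀ x, ρ (b₀ x) = Sum.elim (fun p : Fin (g₀ + g₁) × Bool => if h : g₀ ≤ (p.1 : ℕ) then
      b₁ (Sum.inl (⟨(p.1 : ℕ) - g₀, by omega⟩, p.2)) else (1 : PuncturedSurfaceGroup g₁ 1))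
      (fun _ : Fin r' => (1 : PuncturedSurfaceGroup g₁ 1)) x :=
    fun x => b₀.lift_apply_basis _ x
  have hρι : ∀ (j : Fin g₁) (bit : Bool), ρ (b₀ (Sum.inl (Fin.natAdd g₀ j, bit))) = b₁ (Sum.inl (j, bit)) := by
    rintro ⟨j, hj⟩ bit
    rw [hρ, Sum.elim_inl, dif_pos (by simp)]
    congr 3
    exact Fin.ext (by simp)
  have hρφ : ρ.comp φ = MonoidHom.id _ := by
    refine b₁.ext_hom _ _ fun x => ?_
    rcases x with ⟨j, _ | _⟩ | k
    · rw [MonoidHom.comp_apply, MonoidHom.id_apply, hb₁a, hφa, ← ha, hρι, hb₁a]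
    · rw [MonoidHom.comp_apply, MonoidHom.id_apply, hb₁b, hφb, ← hb, hρι, hb₁b]
    · exact k.elim0
  have hinj : Function.Injective φ := by
    intro x y hxy
    have := congrArg ρ hxy
    rwa [← MonoidHom.comp_apply, ← MonoidHom.comp_apply, hρφ] at this
  refine ⟨(MonoidHom.ofInjective hinj).trans (MulEquiv.subgroupCongr hrange), fun j => ?_, fun j => ?_,
    ?_⟩
  · change ((MonoidHom.ofInjective hinj (a j) : φ.range) : PuncturedSurfaceGroup (g₀ + g₁) (r' + 1)) = _
    rw [MonoidHom.ofInjective_apply, hφa]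
  · change ((MonoidHom.ofInjective hinj (b j) : φ.range) : PuncturedSurfaceGroup (g₀ + g₁) (r' + 1)) = _
    rw [MonoidHom.ofInjective_apply, hφb]
  · change ((MonoidHom.ofInjective hinj (c 0) : φ.range) : PuncturedSurfaceGroup (g₀ + g₁) (r' + 1)) = _
    rw [MonoidHom.ofInjective_apply, hφc]

end Literature.GroupTheory.CombinatorialGroupTheory.PuncturedSurfaceGroup

/-! ### Malnormality of the closed node group `cl ι⟨(∏_{i≥g₀}[a_i,b_i])^{±1}⟩` -/

namespace Literature.AnabelianGeometry.SemiGraphs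

open Literature.GroupTheory.CombinatorialGroupTheory
open Literature.GroupTheory.CombinatorialGroupTheory.PuncturedSurfaceGroup (a b c cuspInertia
  exists_freeGroupBasis_elim_zero exists_mulEquiv_secondHandles)
open SemiGraphOfAnabelioids (IsProSigmaCompletion proSigmaCuspInertiaMalnormal_holds)
open SemiGraphOfAnabelioids.IsProSigmaCompletion (freeFactor_isProSigmaCompletion freeFactor_inf_conj_eq_bot
  map_mem_freeFactor)

section Engine

variable {P : Type} [Group P] [TopologicalSpace P] [IsTopologicalGroup P]
variable [CompactSpace P] [T2Space P] [TotallyDisconnectedSpace P] {Sigma : Set ℕ}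

omit [TopologicalSpace P] [IsTopologicalGroup P] [CompactSpace P] [T2Space P]
  [TotallyDisconnectedSpace P] in
/-- Pushing a conjugate inside a subgroup `H ≤ Π` out to `Π`: `(h • J) ↦ h • J`.
[cite: MochizukiSemiAnbd2006, Ex. 2.10 p.31] -/
theorem map_subtype_conjAct_smul (H : Subgroup P) (J : Subgroup H) (h : H) :
    (ConjAct.toConjAct h • J).map H.subtype = ConjAct.toConjAct (h : P) • J.map H.subtype := by
  ext y
  simp only [Subgroup.mem_map, Subgroup.mem_smul_pointwise_iff_exists, ConjAct.toConjAct_smul,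
    Subgroup.coe_subtype]
  constructor
  · rintro ⟨_, ⟨j, hj, rfl⟩, rfl⟩
    exact ⟨(j : P), ⟨j, hj, rfl⟩, by simp⟩
  · rintro ⟨_, ⟨j, hj, rfl⟩, rfl⟩
    exact ⟨h * j * h⁻¹, ⟨j, hj, rfl⟩, by simp⟩

omit [TopologicalSpace P] [IsTopologicalGroup P] [CompactSpace P] [T2Space P]
  [TotallyDisconnectedSpace P] in
/-- Conjugation preserves inclusions of subgroups. [cite: MochizukiSemiAnbd2006, Ex. 2.10 p.31] -/
theorem conjAct_smul_le_conjAct_smul {A B : Subgroup P} (hAB : A ≤ B) (x : ConjAct P) : x • A ≤ x • B := by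
  intro y hy
  obtain ⟨z, hz, rfl⟩ := (Subgroup.mem_smul_pointwise_iff_exists _ _ _).mp hy
  exact Subgroup.smul_mem_pointwise_smul _ _ _ (hAB hz)

/-- **The closed node group of an unmarked component is MALNORMAL and INFINITE.**  Let
`ι : Γ_{g₀+g₁, r'+1} → Π` be a profinite pro-`Σ` completion (`Σ` a nonempty set of primes), `g₁ ≥ 1`, and
`w = ∏_{i ≥ g₀}[a_i,b_i]` the handle product of the second block (the inverse of the node loop of the
two-component degeneration with `C₁` unmarked).  Then `I = cl ι⟨w⟩` is infinite and `I ∩ x I x⁻¹ = 1` for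
every `x ∉ I`.  PROOF: `F₁ = ⟨a_i, b_i : i ≥ g₀⟩ ≅ Γ_{g₁,1}` with `w⁻¹ ↦ c_0` (`exists_mulEquiv_secondHandles`)
is a free factor, so `cl ι(F₁)` is the pro-`Σ` completion of `Γ_{g₁,1}` (`freeFactor_isProSigmaCompletion`) and
`I` is its closed cusp inertia — infinite and malnormal there (`proSigmaCuspInertiaMalnormal_holds`,
[AbsAnab] Lem. 1.3.7 / [SemiAnbd] Ex. 2.10); and `cl ι(F₁) ∩ x cl ι(F₁) x⁻¹ = 1` for `x ∉ cl ι(F₁)`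
(`freeFactor_inf_conj_eq_bot`). [cite: MochizukiSemiAnbd2006, Ex. 2.10 p.31] -/
theorem secondHandleProd_closure_infinite_and_inf_conj_eq_bot (hne : Sigma.Nonempty)
    (hprime : ∀ p ∈ Sigma, p.Prime) {g₀ g₁ r' : ℕ} (hg₁ : 1 ≤ g₁)
    (ι : PuncturedSurfaceGroup (g₀ + g₁) (r' + 1) →* P) (hι : IsProSigmaCompletion Sigma ι) :
    Infinite ((Subgroup.zpowers (((List.finRange (g₀ + g₁)).map fun i : Fin (g₀ + g₁) =>
        if g₀ ≤ (i : ℕ) then a (r := r' + 1) i * b i * (a i)⁻¹ * (b i)⁻¹ else 1).prod)).map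
          ι).topologicalClosure ∧
      ∀ x : P, x ∉ ((Subgroup.zpowers (((List.finRange (g₀ + g₁)).map fun i : Fin (g₀ + g₁) =>
          if g₀ ≤ (i : ℕ) then a (r := r' + 1) i * b i * (a i)⁻¹ * (b i)⁻¹ else 1).prod)).map
            ι).topologicalClosure →
        ((Subgroup.zpowers (((List.finRange (g₀ + g₁)).map fun i : Fin (g₀ + g₁) =>
            if g₀ ≤ (i : ℕ) then a (r := r' + 1) i * b i * (a i)⁻¹ * (b i)⁻¹ else 1).prod)).map
              ι).topologicalClosure ⊓
          ConjAct.toConjAct x • ((Subgroup.zpowers (((List.finRange (g₀ + g₁)).map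
            fun i : Fin (g₀ + g₁) => if g₀ ≤ (i : ℕ) then a (r := r' + 1) i * b i * (a i)⁻¹ * (b i)⁻¹
              else 1).prod)).map ι).topologicalClosure = ⊥ := by
  classical
  set w : PuncturedSurfaceGroup (g₀ + g₁) (r' + 1) :=
    ((List.finRange (g₀ + g₁)).map fun i : Fin (g₀ + g₁) => if g₀ ≤ (i : ℕ) then
      a (r := r' + 1) i * b i * (a i)⁻¹ * (b i)⁻¹ else 1).prod with hw
  set I : Subgroup P := ((Subgroup.zpowers w).map ι).topologicalClosure with hI
  -- the free factor `F₁ = ⟨a_i, b_i : i ≥ g₀⟩` and its closure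
  obtain ⟨b₀, ha, hb, -⟩ := exists_freeGroupBasis_elim_zero (g₀ + g₁) r'
  set S₁ : Set ((Fin (g₀ + g₁) × Bool) ⊕ Fin r') :=
    {x | Sum.elim (fun p : Fin (g₀ + g₁) × Bool => g₀ ≤ (p.1 : ℕ)) (fun _ : Fin r' => False) x} with hS₁
  set F₁ : Subgroup (PuncturedSurfaceGroup (g₀ + g₁) (r' + 1)) := Subgroup.closure (b₀ '' S₁) with hF₁
  set FF : Subgroup P := (F₁.map ι).topologicalClosure with hFF
  haveI : CompactSpace FF := isCompact_iff_compactSpace.mp (Subgroup.isClosed_topologicalClosure _).isCompact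
  have hce : Topology.IsClosedEmbedding (FF.subtype : FF → P) :=
    (Subgroup.isClosed_topologicalClosure _).isClosedEmbedding_subtypeVal
  -- `cl ι(F₁)` is the pro-`Σ` completion of `F₁ ≅ Γ_{g₁,1}`
  obtain ⟨e, -, -, hec⟩ := exists_mulEquiv_secondHandles g₀ g₁ r' b₀ ha hb
  let ιF : F₁ →* FF := (ι.comp F₁.subtype).codRestrict FF (map_mem_freeFactor b₀ S₁)
  have hιF : IsProSigmaCompletion Sigma ιF := freeFactor_isProSigmaCompletion b₀ S₁ hι
  let ι₁ : PuncturedSurfaceGroup g₁ 1 →* FF := ιF.comp e.toMonoidHom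
  have hι₁ : IsProSigmaCompletion Sigma ι₁ :=
    SemiGraphOfAnabelioids.IsProSigmaCompletion.of_comp_mulEquiv e (fun _ => rfl) hιF
  have hι₁c : ((ι₁ (c 0) : FF) : P) = ι w⁻¹ := by
    change ι ((e (c 0) : PuncturedSurfaceGroup (g₀ + g₁) (r' + 1))) = _
    rw [hec]
  have hhyp : PuncturedSurfaceGroup.IsHyperbolicType g₁ 1 := by
    unfold PuncturedSurfaceGroup.IsHyperbolicType; omega
  obtain ⟨hinf, hmal⟩ := proSigmaCuspInertiaMalnormal_holds Sigma hne hprime g₁ 1 hhyp FF ι₁ hι₁ 0 0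
  set J : Subgroup FF := ((cuspInertia (g := g₁) (0 : Fin 1)).map ι₁).topologicalClosure with hJ
  -- `J` pushed out to `Π` is `I`
  have hJI : J.map FF.subtype = I := by
    rw [hJ, PuncturedSurfaceGroup.cuspInertia, MonoidHom.map_zpowers,
      ← topologicalClosure_map_of_isClosedEmbedding FF.subtype hce, MonoidHom.map_zpowers,
      Subgroup.coe_subtype, hι₁c, map_inv, Subgroup.zpowers_inv, hI, MonoidHom.map_zpowers]
  have hIF : I ≤ FF := by
    rw [← hJI]
    rintro _ ⟨y, -, rfl⟩
    exact y.2
  refine ⟨?_, fun x hx => ?_⟩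
  · rw [← hJI]
    exact Infinite.of_injective (fun j : J => (⟨(j : FF), ⟨j, j.2, rfl⟩⟩ : J.map FF.subtype))
      fun j₁ j₂ h => Subtype.ext (Subtype.ext (congrArg (fun z : J.map FF.subtype => (z : P)) h))
  by_cases hxF : x ∈ FF
  · -- inside `cl ι(F₁)`: malnormality of the cusp inertia
    have hx' : (⟨x, hxF⟩ : FF) ∉ J := fun h => hx (by rw [← hJI]; exact ⟨⟨x, hxF⟩, h, rfl⟩)
    have h1 := hmal ⟨x, hxF⟩ (Or.inr hx')
    have h2 := congrArg (Subgroup.map FF.subtype) h1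
    rw [Subgroup.map_inf _ _ FF.subtype Subtype.val_injective, map_subtype_conjAct_smul, hJI,
      Subgroup.map_bot] at h2
    exact h2
  · -- outside: `cl ι(F₁)` is malnormal
    have h1 := freeFactor_inf_conj_eq_bot b₀ S₁ hι hxF
    rw [eq_bot_iff] at h1 ⊢
    exact le_trans (inf_le_inf hIF (conjAct_smul_le_conjAct_smul hIF _)) h1

end Engine

end Literature.AnabelianGeometry.SemiGraphs

end
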